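import Summits.Langlands.Langlands.Theorems.RationalPeriodQuarterTameDecompositionPrelim
import Summits.Langlands.Langlands.Theorems.RationalPeriodQuarterRationalDescentAlg

/-!
# Preliminaries for `RationalDescent` — child 3 of the lens-1-g38 split of `RationalPeriodQuarter.SemiAnalyticRigidity`

(decomp-langlands node `SemiAnalyticRigiditySplit`, split of stmt-Langlands-2806.)  Transport machinery for the
rational descent: cofinite eventualities under integer shifts, the `n`-step telescoping identity
`f (t+n) - f t = ∑_{j<n} q (t+j)`, finite sums of fractions with RATIONAL denominators, the `n`-step PIECE LEMMA
(on a set `s`, if `f` has a `ℚ`-denominator fraction representation at `t + n` and the coboundary `q` has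
`ℚ`-denominator representations at `t + j`, `j < n`, then `f` is cofinitely ONE fraction with a `ℚ`-denominator
non-vanishing on `s`), and the regularisation `t ↦ limUnder (𝓝[≠] t) f`.  Mathlib + the `TameDecomposition`
preliminaries + the algebraic tail lemma file only.
-/

set_option linter.dupNamespace false

namespace Summit.Langlands.Langlands.Theorems

open Filter Set Topology Polynomial

/-- A cofinite eventuality is stable under the shift `t ↦ t + c`. -/
theorem ratDescent_eventually_cofinite_shift {p : ℝ → Prop} (h : ∀ᶠ t in Filter.cofinite, p t) (c : ℝ) :
    ∀ᶠ t in Filter.cofinite, p (t + c) :=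
  (Function.Injective.tendsto_cofinite (add_left_injective c)).eventually h

/-- `n`-step telescoping of a cofinite coboundary identity. -/
theorem ratDescent_telescope (f q : ℝ → ℂ) (h : ∀ᶠ t in Filter.cofinite, f (t + 1) - f t = q t) :
    ∀ n : ℕ, ∀ᶠ t in Filter.cofinite, f (t + n) - f t = ∑ j ∈ Finset.range n, q (t + j) := by
  intro n
  induction n with
  | zero => exact Filter.Eventually.of_forall fun t => by simp
  | succ n ih =>
    filter_upwards [ih, ratDescent_eventually_cofinite_shift h n] with t ht hs
    rw [Finset.sum_range_succ, ← ht]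
    have : t + ((n + 1 : ℕ) : ℝ) = t + n + 1 := by push_cast; ring
    rw [this]
    linear_combination hs

/-- Finite sums of fractions with rational denominators are one such fraction. -/
theorem ratDescent_sum_fractions_rat {ι : Type*} [DecidableEq ι] (s : Finset ι) (P : ι → ℂ[X])
    (D : ι → ℚ[X]) :
    ∃ P' : ℂ[X], ∀ z : ℂ, (∀ i ∈ s, aeval z (D i) ≠ 0) →
      ∑ i ∈ s, (P i).eval z / aeval z (D i) = P'.eval z / aeval z (∏ i ∈ s, D i) := by
  obtain ⟨P', hP'⟩ := tameDecomp_sum_fractions s P (fun i => (D i).map (algebraMap ℚ ℂ))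
  refine ⟨P', fun z hz => ?_⟩
  have hz' : ∀ i ∈ s, ((D i).map (algebraMap ℚ ℂ)).eval z ≠ 0 := fun i hi => by
    rw [← ratDescent_aeval_eq_eval_map]; exact hz i hi
  have := hP' z hz'
  simp only [← ratDescent_aeval_eq_eval_map] at this
  rw [this, ratDescent_aeval_eq_eval_map, Polynomial.map_prod, Polynomial.eval_prod]

/-- Shifting the variable in `aeval`. -/
theorem ratDescent_aeval_comp_shift (D : ℚ[X]) (c : ℚ) (z : ℂ) :
    aeval z (D.comp (X + C c)) = aeval (z + (c : ℂ)) D := by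
  rw [Polynomial.aeval_comp]
  congr 1
  simp

/-- A nonzero rational polynomial has only finitely many real zeros; beyond a bound there are none (both sides). -/
theorem ratDescent_exists_bound_aeval_ne_zero (D : ℚ[X]) (hD : D ≠ 0) :
    ∃ R : ℝ, ∀ t : ℝ, (R < t ∨ t < -R) → aeval (t : ℂ) D ≠ 0 := by
  have hD' : D.map (algebraMap ℚ ℂ) ≠ 0 := (Polynomial.map_ne_zero_iff (algebraMap ℚ ℂ).injective).2 hD
  have hfin := tameDecomp_finite_eval_eq_zero hD'
  refine ⟨∑ r ∈ hfin.toFinset, |r| + 1, fun t ht h0 => ?_⟩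
  rw [ratDescent_aeval_eq_eval_map] at h0
  have hmem : t ∈ hfin.toFinset := hfin.mem_toFinset.2 h0
  have h1 : |t| ≤ ∑ r ∈ hfin.toFinset, |r| :=
    Finset.single_le_sum (f := fun r : ℝ => |r|) (fun _ _ => abs_nonneg _) hmem
  have h2 := le_abs_self t
  have h3 := neg_abs_le t
  rcases ht with ht | ht <;> linarith

/-- THE PIECE LEMMA.  On a set `s`: if `f` is cofinitely a `ℚ`-denominator fraction wherever `good` holds (with the
denominator non-vanishing there), every `t ∈ s` has `good (t + n)`, the coboundary identity `f (t+1) - f t = q t`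
holds cofinitely, and `q` is a `ℚ`-denominator fraction at `t + j` for `t ∈ s`, `j < n`, then `f` is cofinitely
on `s` ONE fraction whose rational denominator does not vanish on `s`. -/
theorem ratDescent_piece (f q : ℝ → ℂ) (s : Set ℝ) (good : ℝ → Prop) (n : ℕ) (P₂ : ℂ[X]) (D : ℚ[X])
    (hD : ∀ t, good t → aeval (t : ℂ) D ≠ 0)
    (hbase : ∀ᶠ t in Filter.cofinite, good t → f t = P₂.eval (t : ℂ) / aeval (t : ℂ) D)
    (hs : ∀ t ∈ s, good (t + n))
    (hT : ∀ᶠ t in Filter.cofinite, f (t + 1) - f t = q t)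
    (Pj : ℕ → ℂ[X]) (Dj : ℕ → ℚ[X])
    (hj : ∀ j < n, ∀ t ∈ s, aeval ((t : ℂ) + (j : ℂ)) (Dj j) ≠ 0 ∧
      q (t + j) = (Pj j).eval ((t : ℂ) + (j : ℂ)) / aeval ((t : ℂ) + (j : ℂ)) (Dj j)) :
    ∃ (P : ℂ[X]) (Dt : ℚ[X]), (∀ t ∈ s, aeval (t : ℂ) Dt ≠ 0) ∧
      ∀ᶠ t in Filter.cofinite, t ∈ s → f t = P.eval (t : ℂ) / aeval (t : ℂ) Dt := by
  classical
  obtain ⟨Ps, hPs⟩ := ratDescent_sum_fractions_rat (Finset.range n)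
    (fun j => (Pj j).comp (X + C (j : ℂ))) (fun j => (Dj j).comp (X + C (j : ℚ)))
  obtain ⟨Dn, hDn⟩ : ∃ Dn : ℚ[X], Dn = D.comp (X + C (n : ℚ)) := ⟨_, rfl⟩
  obtain ⟨Dπ, hDπ⟩ : ∃ Dπ : ℚ[X], Dπ = ∏ j ∈ Finset.range n, (Dj j).comp (X + C (j : ℚ)) := ⟨_, rfl⟩
  have hDn_ev : ∀ t : ℝ, aeval (t : ℂ) Dn = aeval (((t + n : ℝ)) : ℂ) D := by
    intro t
    rw [hDn, ratDescent_aeval_comp_shift]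
    simp only [Complex.ofReal_add, Complex.ofReal_natCast, Rat.cast_natCast]
  have hDπ_ev : ∀ t : ℝ, aeval (t : ℂ) Dπ = ∏ j ∈ Finset.range n, aeval ((t : ℂ) + (j : ℂ)) (Dj j) := by
    intro t
    rw [hDπ, map_prod]
    exact Finset.prod_congr rfl fun j _ => by
      rw [ratDescent_aeval_comp_shift]; simp only [Rat.cast_natCast]
  have hDn_ne : ∀ t ∈ s, aeval (t : ℂ) Dn ≠ 0 := fun t ht => by
    rw [hDn_ev]; exact hD _ (hs t ht)
  have hDπ_ne : ∀ t ∈ s, aeval (t : ℂ) Dπ ≠ 0 := fun t ht => by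
    rw [hDπ_ev]
    exact Finset.prod_ne_zero_iff.2 fun j hj' => (hj j (Finset.mem_range.1 hj') t ht).1
  refine ⟨P₂.comp (X + C (n : ℂ)) * Dπ.map (algebraMap ℚ ℂ) - Dn.map (algebraMap ℚ ℂ) * Ps,
    Dn * Dπ, fun t ht => ?_, ?_⟩
  · rw [map_mul]; exact mul_ne_zero (hDn_ne t ht) (hDπ_ne t ht)
  · filter_upwards [ratDescent_telescope f q hT n, ratDescent_eventually_cofinite_shift hbase n]
      with t htel hb ht
    have hfn : f (t + n) = P₂.eval (((t + n : ℝ)) : ℂ) / aeval (((t + n : ℝ)) : ℂ) D := hb (hs t ht)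
    have hsum : ∑ j ∈ Finset.range n, q (t + j) = Ps.eval (t : ℂ) / aeval (t : ℂ) Dπ := by
      have hcond : ∀ j ∈ Finset.range n, aeval (t : ℂ) ((Dj j).comp (X + C (j : ℚ))) ≠ 0 := by
        intro j hj'
        rw [ratDescent_aeval_comp_shift]; simp only [Rat.cast_natCast]
        exact (hj j (Finset.mem_range.1 hj') t ht).1
      have := hPs (t : ℂ) hcond
      rw [hDπ, ← this]
      refine Finset.sum_congr rfl fun j hj' => ?_
      rw [(hj j (Finset.mem_range.1 hj') t ht).2, Polynomial.eval_comp, ratDescent_aeval_comp_shift]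
      simp only [Polynomial.eval_add, Polynomial.eval_X, Polynomial.eval_C, Rat.cast_natCast]
    have hft : f t = f (t + n) - ∑ j ∈ Finset.range n, q (t + j) := by rw [← htel]; ring
    rw [hft, hfn, hsum, ← hDn_ev, div_sub_div _ _ (hDn_ne t ht) (hDπ_ne t ht), map_mul]
    congr 1
    simp only [Polynomial.eval_sub, Polynomial.eval_mul, Polynomial.eval_comp, Polynomial.eval_add,
      Polynomial.eval_X, Polynomial.eval_C, ← ratDescent_aeval_eq_eval_map]
    push_cast
    ring

/-- Regularisation by punctured limits: on an open set where `f` is cofinitely a fraction with non-vanishing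
denominator, `t ↦ limUnder (𝓝[≠] t) f` IS that fraction everywhere on the set and agrees with `f` cofinitely. -/
theorem ratDescent_lim_piece (f : ℝ → ℂ) (s : Set ℝ) (hs : IsOpen s) (P : ℂ[X]) (Dt : ℚ[X])
    (hD : ∀ x ∈ s, aeval (x : ℂ) Dt ≠ 0)
    (hf : ∀ᶠ t in Filter.cofinite, t ∈ s → f t = P.eval (t : ℂ) / aeval (t : ℂ) Dt) :
    (∀ x ∈ s, limUnder (𝓝[≠] x) f = P.eval (x : ℂ) / aeval (x : ℂ) Dt) ∧
      ∀ᶠ t in Filter.cofinite, t ∈ s → f t = limUnder (𝓝[≠] t) f := by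
  have hcont : ∀ x ∈ s, ContinuousAt (fun t : ℝ => P.eval (t : ℂ) / aeval (t : ℂ) Dt) x := by
    intro x hx
    have h1 : Continuous fun t : ℝ => P.eval (t : ℂ) :=
      (Polynomial.continuous P).comp Complex.continuous_ofReal
    have h2 : Continuous fun t : ℝ => aeval (t : ℂ) Dt := by
      simp only [ratDescent_aeval_eq_eval_map]
      exact (Polynomial.continuous _).comp Complex.continuous_ofReal
    exact h1.continuousAt.div h2.continuousAt (hD x hx)
  have hlim : ∀ x ∈ s, limUnder (𝓝[≠] x) f = P.eval (x : ℂ) / aeval (x : ℂ) Dt := by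
    intro x hx
    apply Filter.Tendsto.limUnder_eq
    have hev : ∀ᶠ (t : ℝ) in 𝓝[≠] x, P.eval (t : ℂ) / aeval (t : ℂ) Dt = f t := by
      have h1 := tameDecomp_eventually_nhdsNE_of_cofinite hf x
      have h2 : ∀ᶠ (t : ℝ) in 𝓝[≠] x, t ∈ s := mem_nhdsWithin_of_mem_nhds (hs.mem_nhds hx)
      filter_upwards [h1, h2] with t h1 h2 using (h1 h2).symm
    exact ((hcont x hx).tendsto.mono_left nhdsWithin_le_nhds).congr' hev
  refine ⟨hlim, ?_⟩
  filter_upwards [hf] with t ht hts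
  rw [hlim t hts, ht hts]

end Summit.Langlands.Langlands.Theorems
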